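import Mathlib
import Summits.NavierStokesRegularity.NavierStokesRegularity.Theorems.FilamentSkeletonRssDefectColumnGateAzimuthalBlockPrelim

/-!
# Route `FilamentSkeletonRss` · crux `TransverseReduction1AG` (stmt-NavierStokesRegularity-27853; A1L twin `TransverseReduction1AL`,
# stmt-23297) · line `defect_column_gate_1AG/1AL` — the AZIMUTHAL BLOCKS `|m| ≥ 3` of the localised sectional waist gate
# `WaistColumnGateLoc1A` (stub S2a-loc) for the symmetric column WITH AN ARBITRARY ROTATION PROFILE: a-priori bound in the sectional
# sup-weight, uniform in the localisation radius, in the rotation profile and in `m`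

Helper file (`--supports stmt-NavierStokesRegularity-27853 --as helper`; seat ns-filament-s2aloc-p1 g2, MINT req187 no-hit branch; briefs v5
brick B2 «`|m| ≥ 1` radial blocks of the SYMMETRIC column in sup-weights»).  Second of two files (`…AzimuthalBlockPrelim.lean` = the maximum
principle `maxPrinciple_of_wronskian` and the symbol inequality `azimuthalBlock_symbol_lower`; this).  Companions: the LEAD's m = 0 block `radialBlock_apriori`
(`Theorems/…RadialBlock.lean`, p661788), the m = 2, `Rc = 0` block `quadrupoleBlock_apriori` (`Theorems/…QuadrupoleBlock.lean`, p667905), the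
m = 1 closed forms (`Theorems/…DipoleSector(Rot).lean`, `…TranslationMode.lean`).

THE BLOCK.  Symmetric sectional strain `B_⊥ = −(γ/2)·Id + ρ·J`, Gaussian column of circulation `Rc`, axially constant horizontal
perturbation of azimuthal order `m`: `ω = Re[w(r) e^{imθ}]`, `w = a + i b`.  In `u = r²` the frozen sectional operator of `colForceVort_eq`
acts on the mode as `T w + i V(u) w + (Biot–Savart coupling)`, `T w = −(4u w′ + γu w)′ + (m²/u) w`, where the REAL potential
`V(u) = m(ρ + Rc·Ω(r))` collects the frame rotation and the differential rotation of the column (`Ω` = angular velocity of the unit Gaussian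
vortex), and the Biot–Savart coupling `i m Rc (γ/2) e^{−γu/4} φ_m` (`φ_m` = stream coefficient) is carried here on the right-hand side.  As a
REAL SYSTEM for `(a, b)`:
`−(4u a′ + γu a)′ + (m²/u) a − V b = f₁`,  `−(4u b′ + γu b)′ + (m²/u) b + V a = f₂`  on `(0, ∞)`.

THE ESTIMATE (`azimuthalBlock_apriori_sq`, `azimuthalBlock_apriori`).  If `m² ≥ 9`, `(1+u)²|f_i| ≤ M`, `a = b = 0` on `[U, ∞)` and
`a(0) = b(0) = 0` (an azimuthal coefficient of order `m ≥ 1` vanishes on the axis), then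
`(1+u)⁴ (a² + b²) ≤ (16 (2 + 13/γ + γ/13)²/γ)² · M²` on `[0, ∞)` — for EVERY real function `V`, every `U > 0`, every `m² ≥ 9`.  So the local
part of every azimuthal block `|m| ≥ 3` of the symmetric column is invertible in the sectional sup-weight uniformly in the localisation radius
`R = √U`, in the circulation `Rc` and in the frame rotation (both enter only through `V`), including the counter-rotating / critical-layer
profiles where `V` changes sign.

THE MECHANISM (no closed forms, no special functions).  (1) The potential DROPS OUT of the flux identity for the modulus `s = a² + b²`:
`(u e^{γu/4} s′)′ = (e^{γu/4}/2)·[4u(a′² + b′²) + (m²/u − γ) s − (a f₁ + b f₂)]`.  (2) `ψ(u) = (u + κ)^{−4}`, `κ = 13/γ`, is a GLOBAL strict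
supersolution of the resulting modulus operator as soon as `m² ≥ 9`: the relevant symbol is
`m²(u+κ)² + γu³ − 32u² + κ(8 − γκ)u ≥ γu(u+κ)²/8`, which after `x = γu` is the cubic inequality `7x³ − 210x² + 1183x + 12168 ≥ 0` on `x ≥ 0`
(`azimuthalBlock_cubic_nonneg`, `azimuthalBlock_symbol_lower`).  (3) A first-order maximum principle (`maxPrinciple_of_wronskian`): for
`v = s·(u+κ)⁴` the Wronskian-type flux `Wr = u·((u+κ) s′ + 4 s)` is a positive multiple of `v′`, and at an interior critical point of `v` above
the threshold `256 M²(1+κ)⁴/γ²` its derivative is STRICTLY positive by (1)–(2) — so `v` cannot have an interior maximum above the threshold;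
`v(0) = v(U) = 0`.  Only first derivatives of `a, b` and of the fluxes `4u a′ + γu a`, `4u b′ + γu b` are used (LEAD-style hypotheses on `(0,∞)`
plus continuity on `[0,∞)`).

WHAT THIS IS NOT (honest): the Biot–Savart coupling is a source term here, so the brick closes the LOCAL part of B2 for `|m| ≥ 3`; the core
smallness of `φ_m` at large `Rc` (fast rotation), the orders `m = 1, 2`, the strain / tilt couplings and the axial reduction are not touched.
HONEST FRAMING: elementary analysis about ONE family of blocks of ONE linear MODEL operator of a hypothetical blow-up route (MODEL rung, negative
side); `WaistColumnGateLoc1A`, `TransverseReduction1AG/1AL` are neither proved nor refuted here; nothing in this file bears on Navier–Stokes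
regularity.
-/

set_option linter.dupNamespace false

noncomputable section

namespace Summit.NavierStokesRegularity.NavierStokesRegularity.Theorems.DefectColumnGate

open scoped Topology
open Set Filter

/-! ## 3. The azimuthal block a-priori estimate -/

set_option maxHeartbeats 1600000 in
/-- **The azimuthal blocks `|m| ≥ 3` of S2a-loc for the symmetric column with an arbitrary real rotation potential — squared form.**
Data in `u = r²`: `a, b` (real and imaginary parts of the order-`m` vorticity coefficient) continuous on `[0,∞)` with `a(0) = b(0) = 0`,
derivatives `a₁, b₁` on `(0,∞)`; the block `(4u a₁ + γu a)′ = (m²/u) a − V b − f₁`, `(4u b₁ + γu b)′ = (m²/u) b + V a − f₂` on `(0,∞)` with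
ANY `V : ℝ → ℝ`; data `(1+u)²|f₁|, (1+u)²|f₂| ≤ M`; support `a = b = 0` on `[U,∞)`, `U > 0`; order `m² ≥ 9`.  Conclusion:
`(1+u)⁴ (a² + b²) ≤ (16(2 + 13/γ + γ/13)²/γ)² M²` on `[0,∞)` — uniformly in `U`, `V`, `m`. -/
theorem azimuthalBlock_apriori_sq {γ m U M : ℝ} {a a₁ b b₁ f₁ f₂ V : ℝ → ℝ} (hγ : 0 < γ) (hm : 9 ≤ m ^ 2) (hU : 0 < U)
    (ha : ContinuousOn a (Ici 0)) (hb : ContinuousOn b (Ici 0)) (ha0 : a 0 = 0) (hb0 : b 0 = 0)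
    (hdera : ∀ u, 0 < u → HasDerivAt a (a₁ u) u) (hderb : ∀ u, 0 < u → HasDerivAt b (b₁ u) u)
    (hΦa : ∀ u, 0 < u →
      HasDerivAt (fun s => 4 * s * a₁ s + γ * s * a s) (m ^ 2 / u * a u - V u * b u - f₁ u) u)
    (hΦb : ∀ u, 0 < u →
      HasDerivAt (fun s => 4 * s * b₁ s + γ * s * b s) (m ^ 2 / u * b u + V u * a u - f₂ u) u)
    (hf₁ : ∀ u, 0 < u → (1 + u) ^ 2 * |f₁ u| ≤ M) (hf₂ : ∀ u, 0 < u → (1 + u) ^ 2 * |f₂ u| ≤ M)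
    (hsuppa : ∀ u, U ≤ u → a u = 0) (hsuppb : ∀ u, U ≤ u → b u = 0) :
    ∀ u, 0 ≤ u → (1 + u) ^ 4 * (a u ^ 2 + b u ^ 2) ≤ (16 * (2 + 13 / γ + γ / 13) ^ 2 / γ) ^ 2 * M ^ 2 := by
  have hM : 0 ≤ M := le_trans (by positivity) (hf₁ 1 one_pos)
  have hγ0 : γ ≠ 0 := hγ.ne'
  -- the shift of the comparison function
  set κ : ℝ := 13 / γ with hκdef
  have hκ : 0 < κ := by positivity
  have hγκ : γ * κ = 13 := by rw [hκdef]; field_simp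
  -- the threshold
  set K₀ : ℝ := 256 * M ^ 2 * (1 + κ) ^ 4 / γ ^ 2 with hK₀def
  have hK₀ : 0 ≤ K₀ := by positivity
  -- the players
  set S : ℝ → ℝ := fun t => a t ^ 2 + b t ^ 2 with hSdef
  set v : ℝ → ℝ := fun t => S t * (t + κ) ^ 4 with hvdef
  set v₁ : ℝ → ℝ := fun t => (2 * a t * a₁ t + 2 * b t * b₁ t) * (t + κ) ^ 4 + S t * (4 * (t + κ) ^ 3) with hv₁def
  set Wr : ℝ → ℝ := fun t => (t + κ) * ((a t * (4 * t * a₁ t + γ * t * a t) + b t * (4 * t * b₁ t + γ * t * b t)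
      - γ * t * S t) / 2) + 4 * t * S t with hWrdef
  set P : ℝ → ℝ := fun t => t / (t + κ) ^ 3 with hPdef
  -- pointwise data bounds
  have hf₁' : ∀ u, 0 < u → |f₁ u| ≤ M / (1 + u) ^ 2 := fun u hu => by
    rw [le_div_iff₀ (by positivity)]; linarith [hf₁ u hu]
  have hf₂' : ∀ u, 0 < u → |f₂ u| ≤ M / (1 + u) ^ 2 := fun u hu => by
    rw [le_div_iff₀ (by positivity)]; linarith [hf₂ u hu]
  -- §A: the maximum principle on `[0, U]` gives `v ≤ K₀`
  have hMP : ∀ u ∈ Icc 0 U, v u ≤ K₀ := by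
    refine maxPrinciple_of_wronskian (v := v) (v₁ := v₁) (Wr := Wr) (P := P) hU.le ?_ ?_ ?_ ?_ ?_ ?_ ?_
    · -- continuity of `v` on `[0, U]`
      have hS : ContinuousOn S (Icc 0 U) := by
        have ha' := ha.mono (show Icc 0 U ⊆ Ici 0 from fun t ht => ht.1)
        have hb' := hb.mono (show Icc 0 U ⊆ Ici 0 from fun t ht => ht.1)
        exact (ha'.pow 2).add (hb'.pow 2)
      exact hS.mul ((continuousOn_id.add continuousOn_const).pow 4)
    · -- derivative of `v`
      intro u hu
      have ha' := hdera u hu.1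
      have hb' := hderb u hu.1
      have hS' : HasDerivAt S (2 * a u * a₁ u + 2 * b u * b₁ u) u := by
        have h1 : HasDerivAt (fun t => a t ^ 2) (2 * a u * a₁ u) u :=
          (ha'.fun_pow 2).congr_deriv (by norm_num)
        have h2 : HasDerivAt (fun t => b t ^ 2) (2 * b u * b₁ u) u :=
          (hb'.fun_pow 2).congr_deriv (by norm_num)
        exact h1.add h2
      have hk : HasDerivAt (fun t : ℝ => (t + κ) ^ 4) (4 * (u + κ) ^ 3) u :=
        (((hasDerivAt_id' u).add_const κ).fun_pow 4).congr_deriv (by norm_num)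
      exact hS'.mul hk
    · -- `Wr = P · v₁`
      intro u hu
      have huκ : u + κ ≠ 0 := by linarith [hu.1]
      simp only [hWrdef, hPdef, hv₁def, hSdef]
      field_simp
      ring
    · -- `P > 0`
      intro u hu
      simp only [hPdef]
      have hu0 : 0 < u := hu.1
      have : 0 < u + κ := by linarith
      positivity
    · -- STRICT positivity of `Wr′` at critical points above the threshold
      intro u hu hvK hv₁0
      have hu0 : 0 < u := hu.1
      have hu0' : u ≠ 0 := hu0.ne'
      have huκ : 0 < u + κ := by linarith
      have huκ' : u + κ ≠ 0 := huκ.ne'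
      have ha' := hdera u hu0
      have hb' := hderb u hu0
      have hA := hΦa u hu0
      have hB := hΦb u hu0
      -- derivative of `S`
      have hS' : HasDerivAt S (2 * a u * a₁ u + 2 * b u * b₁ u) u := by
        have h1 : HasDerivAt (fun t => a t ^ 2) (2 * a u * a₁ u) u :=
          (ha'.fun_pow 2).congr_deriv (by norm_num)
        have h2 : HasDerivAt (fun t => b t ^ 2) (2 * b u * b₁ u) u :=
          (hb'.fun_pow 2).congr_deriv (by norm_num)
        exact h1.add h2
      -- derivative of the inner bracket `G`
      have hG : HasDerivAt (fun t => (a t * (4 * t * a₁ t + γ * t * a t) + b t * (4 * t * b₁ t + γ * t * b t)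
          - γ * t * S t) / 2)
          ((a₁ u * (4 * u * a₁ u + γ * u * a u) + a u * (m ^ 2 / u * a u - V u * b u - f₁ u)
            + (b₁ u * (4 * u * b₁ u + γ * u * b u) + b u * (m ^ 2 / u * b u + V u * a u - f₂ u))
            - (γ * S u + γ * u * (2 * a u * a₁ u + 2 * b u * b₁ u))) / 2) u := by
        have h1 := ha'.mul hA
        have h2 := hb'.mul hB
        have h3 : HasDerivAt (fun t => γ * t * S t) (γ * S u + γ * u * (2 * a u * a₁ u + 2 * b u * b₁ u)) u := by
          have hγt : HasDerivAt (fun t : ℝ => γ * t) γ u := by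
            simpa using (hasDerivAt_id' u).const_mul γ
          exact hγt.mul hS'
        exact ((h1.add h2).sub h3).div_const 2
      have h1κ : HasDerivAt (fun t : ℝ => t + κ) 1 u := (hasDerivAt_id' u).add_const κ
      have h4t : HasDerivAt (fun t : ℝ => 4 * t) 4 u := by simpa using (hasDerivAt_id' u).const_mul (4:ℝ)
      have hWrD := (h1κ.mul hG).add (h4t.mul hS')
      -- name the derivative
      set G : ℝ := (a u * (4 * u * a₁ u + γ * u * a u) + b u * (4 * u * b₁ u + γ * u * b u) - γ * u * S u) / 2 with hGdef
      set G' : ℝ := ((a₁ u * (4 * u * a₁ u + γ * u * a u) + a u * (m ^ 2 / u * a u - V u * b u - f₁ u)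
            + (b₁ u * (4 * u * b₁ u + γ * u * b u) + b u * (m ^ 2 / u * b u + V u * a u - f₂ u))
            - (γ * S u + γ * u * (2 * a u * a₁ u + 2 * b u * b₁ u))) / 2) with hG'def
      set D : ℝ := 1 * G + (u + κ) * G' + (4 * S u + 4 * u * (2 * a u * a₁ u + 2 * b u * b₁ u)) with hDdef
      have hWrD' : HasDerivAt Wr D u := by
        have e : Wr = fun t => (t + κ) * ((a t * (4 * t * a₁ t + γ * t * a t) + b t * (4 * t * b₁ t + γ * t * b t)
            - γ * t * S t) / 2) + 4 * t * S t := by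
          funext t; simp only [hWrdef]
        rw [e]; exact hWrD
      refine ⟨D, ?_, hWrD'⟩
      -- `Wr u = 0` at the critical point
      have hWr0 : Wr u = 0 := by
        have e1 : Wr u = P u * v₁ u := by
          simp only [hWrdef, hPdef, hv₁def, hSdef]
          field_simp
          ring
        rw [e1, hv₁0, mul_zero]
      have hWr0' : (u + κ) * G + 4 * u * S u = 0 := by
        have : Wr u = (u + κ) * G + 4 * u * S u := by simp only [hWrdef, hGdef]
        rw [← this]; exact hWr0
      -- the key algebraic identity for `D`
      set poly : ℝ := m ^ 2 * (u + κ) ^ 2 + γ * u ^ 3 - 32 * u ^ 2 + κ * (8 - γ * κ) * u with hpolydef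
      have hDid : D = 2 * u * (u + κ) * (a₁ u ^ 2 + b₁ u ^ 2) + S u * (poly / (2 * u * (u + κ)))
          - (u + κ) * (a u * f₁ u + b u * f₂ u) / 2
          + (5 - γ * (u + κ) / 4) / (u + κ) * ((u + κ) * G + 4 * u * S u) := by
        simp only [hDdef, hGdef, hG'def, hpolydef, hSdef]
        field_simp
        ring
      rw [hWr0', mul_zero, add_zero] at hDid
      -- lower bound of the symbol
      have hpoly : γ * u * (u + κ) ^ 2 / 8 ≤ poly := by
        have := azimuthalBlock_symbol_lower (m := m) hγ hm hu0.le
        simp only [hpolydef, hκdef] at this ⊢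
        exact this
      have hBr : γ * (u + κ) / 16 ≤ poly / (2 * u * (u + κ)) := by
        rw [le_div_iff₀ (by positivity)]
        have : γ * (u + κ) / 16 * (2 * u * (u + κ)) = γ * u * (u + κ) ^ 2 / 8 := by ring
        linarith [this, hpoly]
      have hS0 : 0 ≤ S u := by simp only [hSdef]; positivity
      -- from the threshold: `S u > 256 M² / (γ² (1+u)⁴)`
      have hSbig : 256 * M ^ 2 / (γ ^ 2 * (1 + u) ^ 4) < S u := by
        have hv' : K₀ < S u * (u + κ) ^ 4 := by simpa [hvdef] using hvK
        have hcmp : (u + κ) ^ 4 ≤ (1 + κ) ^ 4 * (1 + u) ^ 4 := by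
          rw [← mul_pow]
          apply pow_le_pow_left₀ huκ.le
          nlinarith [hu0.le, hκ.le]
        have h1 : 256 * M ^ 2 * (1 + κ) ^ 4 / γ ^ 2 < S u * ((1 + κ) ^ 4 * (1 + u) ^ 4) := by
          calc 256 * M ^ 2 * (1 + κ) ^ 4 / γ ^ 2 = K₀ := by rw [hK₀def]
            _ < S u * (u + κ) ^ 4 := hv'
            _ ≤ S u * ((1 + κ) ^ 4 * (1 + u) ^ 4) := mul_le_mul_of_nonneg_left hcmp hS0
        rw [div_lt_iff₀ (by positivity)]
        have h1' := h1
        rw [div_lt_iff₀ (by positivity)] at h1'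
        have hk4 : 0 < (1 + κ) ^ 4 := by positivity
        nlinarith [h1', hk4]
      -- the data term is dominated
      set t : ℝ := 16 * M / (γ * (1 + u) ^ 2) with htdef
      have ht0 : 0 ≤ t := by positivity
      have ht2 : t ^ 2 = 256 * M ^ 2 / (γ ^ 2 * (1 + u) ^ 4) := by
        rw [htdef, div_pow]; congr 1 <;> ring
      have hSt : t ^ 2 < S u := by rw [ht2]; exact hSbig
      have hSpos : 0 < S u := lt_of_le_of_lt (sq_nonneg t) hSt
      have hab : (|a u| + |b u|) ^ 2 ≤ 2 * S u := by
        simp only [hSdef]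
        nlinarith [sq_nonneg (|a u| - |b u|), sq_abs (a u), sq_abs (b u)]
      have hdom : (|a u| + |b u|) * t < 2 * S u := by
        have hsq : ((|a u| + |b u|) * t) ^ 2 < (2 * S u) ^ 2 := by
          have : ((|a u| + |b u|) * t) ^ 2 = (|a u| + |b u|) ^ 2 * t ^ 2 := by ring
          rw [this]
          have h2 : (|a u| + |b u|) ^ 2 * t ^ 2 ≤ 2 * S u * t ^ 2 :=
            mul_le_mul_of_nonneg_right hab (sq_nonneg t)
          have h3 : 2 * S u * t ^ 2 < 2 * S u * S u := by nlinarith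
          nlinarith
        have h2S : 0 ≤ 2 * S u := by linarith
        exact lt_of_pow_lt_pow_left₀ 2 h2S hsq
      have hdata : (u + κ) * (a u * f₁ u + b u * f₂ u) / 2 < S u * (γ * (u + κ) / 16) := by
        have h1 : a u * f₁ u + b u * f₂ u ≤ (|a u| + |b u|) * (M / (1 + u) ^ 2) := by
          have e1 : a u * f₁ u ≤ |a u| * |f₁ u| := by
            rw [← abs_mul]; exact le_abs_self _
          have e2 : b u * f₂ u ≤ |b u| * |f₂ u| := by
            rw [← abs_mul]; exact le_abs_self _
          have e3 : |a u| * |f₁ u| ≤ |a u| * (M / (1 + u) ^ 2) :=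
            mul_le_mul_of_nonneg_left (hf₁' u hu0) (abs_nonneg _)
          have e4 : |b u| * |f₂ u| ≤ |b u| * (M / (1 + u) ^ 2) :=
            mul_le_mul_of_nonneg_left (hf₂' u hu0) (abs_nonneg _)
          linarith
        have h2 : (|a u| + |b u|) * (M / (1 + u) ^ 2) = (|a u| + |b u|) * t * (γ / 16) := by
          rw [htdef]; field_simp
        have h3 : (|a u| + |b u|) * t * (γ / 16) < 2 * S u * (γ / 16) :=
          mul_lt_mul_of_pos_right hdom (by positivity)
        have h4 : (u + κ) * (a u * f₁ u + b u * f₂ u) / 2 ≤ (u + κ) * ((|a u| + |b u|) * t * (γ / 16)) / 2 := by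
          have := mul_le_mul_of_nonneg_left (h1.trans_eq h2) huκ.le
          linarith
        have h5 : (u + κ) * ((|a u| + |b u|) * t * (γ / 16)) / 2 < (u + κ) * (2 * S u * (γ / 16)) / 2 := by
          have := mul_lt_mul_of_pos_left h3 huκ
          linarith
        have h6 : (u + κ) * (2 * S u * (γ / 16)) / 2 = S u * (γ * (u + κ) / 16) := by ring
        linarith
      -- conclusion
      have hder2 : 0 ≤ 2 * u * (u + κ) * (a₁ u ^ 2 + b₁ u ^ 2) := by positivity
      have hmain : S u * (γ * (u + κ) / 16) ≤ S u * (poly / (2 * u * (u + κ))) :=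
        mul_le_mul_of_nonneg_left hBr hS0
      rw [hDid]
      linarith
    · -- `v 0 ≤ K₀`
      simp only [hvdef, hSdef, ha0, hb0]
      simpa using hK₀
    · -- `v U ≤ K₀`
      simp only [hvdef, hSdef, hsuppa U le_rfl, hsuppb U le_rfl]
      simpa using hK₀
  -- §B: from `v ≤ K₀` on `[0,U]` and the support to the weighted bound on `[0,∞)`
  intro u hu
  have hS0 : 0 ≤ a u ^ 2 + b u ^ 2 := by positivity
  have huκ : 0 < u + κ := by linarith
  have hvle : (a u ^ 2 + b u ^ 2) * (u + κ) ^ 4 ≤ K₀ := by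
    rcases le_or_gt u U with h | h
    · have := hMP u ⟨hu, h⟩
      simpa [hvdef, hSdef] using this
    · rw [hsuppa u h.le, hsuppb u h.le]
      simpa using hK₀
  -- `(1+u) ≤ (1 + 1/κ)(u+κ)`
  have hcmp : (1 + u) ^ 4 ≤ ((1 + 1 / κ) * (u + κ)) ^ 4 := by
    apply pow_le_pow_left₀ (by linarith)
    have : (1 + 1 / κ) * (u + κ) = 1 + u + κ + u / κ := by field_simp; ring
    rw [this]
    have : 0 ≤ u / κ := by positivity
    linarith
  have hfin : (1 + u) ^ 4 * (a u ^ 2 + b u ^ 2) ≤ (1 + 1 / κ) ^ 4 * K₀ := by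
    calc (1 + u) ^ 4 * (a u ^ 2 + b u ^ 2)
        ≤ ((1 + 1 / κ) * (u + κ)) ^ 4 * (a u ^ 2 + b u ^ 2) := mul_le_mul_of_nonneg_right hcmp hS0
      _ = (1 + 1 / κ) ^ 4 * ((a u ^ 2 + b u ^ 2) * (u + κ) ^ 4) := by ring
      _ ≤ (1 + 1 / κ) ^ 4 * K₀ := mul_le_mul_of_nonneg_left hvle (by positivity)
  have hconst : (1 + 1 / κ) ^ 4 * K₀ = (16 * (2 + 13 / γ + γ / 13) ^ 2 / γ) ^ 2 * M ^ 2 := by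
    rw [hK₀def, hκdef]
    field_simp
    ring
  linarith [hfin, hconst]

/-- **The azimuthal blocks `|m| ≥ 3` of S2a-loc (symmetric column, arbitrary rotation potential) — a-priori bound in the sectional
sup-weight.**  Same hypotheses as `azimuthalBlock_apriori_sq`; conclusion `(1+u)²|a| ≤ C M` and `(1+u)²|b| ≤ C M` on `[0,∞)` with
`C = 16(2 + 13/γ + γ/13)²/γ` depending on `γ` ONLY (not on `U = R²`, not on `V` — i.e. neither on the circulation `Rc` nor on the frame
rotation — and not on `m`). -/
theorem azimuthalBlock_apriori {γ : ℝ} (hγ : 0 < γ) :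
    ∃ C : ℝ, 0 < C ∧ ∀ (m U M : ℝ) (a a₁ b b₁ f₁ f₂ V : ℝ → ℝ), 9 ≤ m ^ 2 → 0 < U →
      ContinuousOn a (Ici 0) → ContinuousOn b (Ici 0) → a 0 = 0 → b 0 = 0 →
      (∀ u, 0 < u → HasDerivAt a (a₁ u) u) → (∀ u, 0 < u → HasDerivAt b (b₁ u) u) →
      (∀ u, 0 < u → HasDerivAt (fun s => 4 * s * a₁ s + γ * s * a s) (m ^ 2 / u * a u - V u * b u - f₁ u) u) →
      (∀ u, 0 < u → HasDerivAt (fun s => 4 * s * b₁ s + γ * s * b s) (m ^ 2 / u * b u + V u * a u - f₂ u) u) →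
      (∀ u, 0 < u → (1 + u) ^ 2 * |f₁ u| ≤ M) → (∀ u, 0 < u → (1 + u) ^ 2 * |f₂ u| ≤ M) →
      (∀ u, U ≤ u → a u = 0) → (∀ u, U ≤ u → b u = 0) →
      ∀ u, 0 ≤ u → (1 + u) ^ 2 * |a u| ≤ C * M ∧ (1 + u) ^ 2 * |b u| ≤ C * M := by
  refine ⟨16 * (2 + 13 / γ + γ / 13) ^ 2 / γ, by positivity, ?_⟩
  intro m U M a a₁ b b₁ f₁ f₂ V hm hU ha hb ha0 hb0 hdera hderb hΦa hΦb hf₁ hf₂ hsuppa hsuppb u hu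
  have hM : 0 ≤ M := le_trans (by positivity) (hf₁ 1 one_pos)
  have hsq := azimuthalBlock_apriori_sq hγ hm hU ha hb ha0 hb0 hdera hderb hΦa hΦb hf₁ hf₂ hsuppa hsuppb u hu
  set C : ℝ := 16 * (2 + 13 / γ + γ / 13) ^ 2 / γ with hCdef
  have hC : 0 ≤ C := by positivity
  have hCM : 0 ≤ C * M := mul_nonneg hC hM
  have h4 : (1 + u) ^ 4 = ((1 + u) ^ 2) ^ 2 := by ring
  constructor
  · have h1 : ((1 + u) ^ 2 * |a u|) ^ 2 ≤ (C * M) ^ 2 := by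
      have : ((1 + u) ^ 2 * |a u|) ^ 2 = (1 + u) ^ 4 * a u ^ 2 := by rw [mul_pow, sq_abs, h4]
      rw [this]
      have : (1 + u) ^ 4 * a u ^ 2 ≤ (1 + u) ^ 4 * (a u ^ 2 + b u ^ 2) := by
        have : 0 ≤ (1 + u) ^ 4 * b u ^ 2 := by positivity
        nlinarith
      calc (1 + u) ^ 4 * a u ^ 2 ≤ (1 + u) ^ 4 * (a u ^ 2 + b u ^ 2) := this
        _ ≤ C ^ 2 * M ^ 2 := hsq
        _ = (C * M) ^ 2 := by ring
    exact (abs_le_of_sq_le_sq' h1 hCM).2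
  · have h1 : ((1 + u) ^ 2 * |b u|) ^ 2 ≤ (C * M) ^ 2 := by
      have : ((1 + u) ^ 2 * |b u|) ^ 2 = (1 + u) ^ 4 * b u ^ 2 := by rw [mul_pow, sq_abs, h4]
      rw [this]
      have : (1 + u) ^ 4 * b u ^ 2 ≤ (1 + u) ^ 4 * (a u ^ 2 + b u ^ 2) := by
        have : 0 ≤ (1 + u) ^ 4 * a u ^ 2 := by positivity
        nlinarith
      calc (1 + u) ^ 4 * b u ^ 2 ≤ (1 + u) ^ 4 * (a u ^ 2 + b u ^ 2) := this
        _ ≤ C ^ 2 * M ^ 2 := hsq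
        _ = (C * M) ^ 2 := by ring
    exact (abs_le_of_sq_le_sq' h1 hCM).2

end Summit.NavierStokesRegularity.NavierStokesRegularity.Theorems.DefectColumnGate

end
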